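import Literature.MathematicalPhysics.QuantumLattice.LatticeGaugeDLRFreeEnergyProofs
import Literature.MathematicalPhysics.QuantumFieldTheory.LatticeRPCauchySchwarz
import Literature.MathematicalPhysics.QuantumFieldTheory.ChatterjeeScaleComparison
import Literature.MathematicalPhysics.QuantumFieldTheory.ConstructiveQFTWave0Proofs
import Literature.RepresentationTheory.CompactGroups.UnitaryTrick
import HarnessLib

/-!
# Cruxes/IR — `rp_doubling`: reflection positivity in lattice hyperplanes ("through sites") for the
product Haar measure, and the free-cube doubling `Z(B_m)^16 ≤ Z(B_{2m-1})` (Glimm–Jaffe §10.5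
multiple reflections, transplanted to Wilson's lattice gauge theory with free boundary condition).

Ideator `ym-ir-idea-5` g7 (lens: chessboard / RP transfer-matrix bounds). Discharges the typed
hypothesis `FreeCubeRPDoubling` of `Lines/pressure_monotone_tm.lean` §5.
-/

open MeasureTheory Finset Filter
open scoped ComplexConjugate

namespace Summit.QuantumFields.YangMills.Cruxes.IR.RPDoubling

open Literature.MathematicalPhysics.QuantumFieldTheory
open Literature.MathematicalPhysics.QuantumLattice

noncomputable section

/-! ## §1 Site reflections of the discrete torus and of its gauge configurations -/

section TorusGeometry

variable {d L : ℕ}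

/-- The reflection of the torus `(ℤ/L)^d` in the lattice hyperplane `x_i = c`. -/
def siteReflect (i : Fin d) (c : ZMod L) (x : Site d L) : Site d L :=
  Function.update x i (c + c - x i)

@[simp] theorem siteReflect_apply_self (i : Fin d) (c : ZMod L) (x : Site d L) :
    siteReflect i c x i = c + c - x i := by
  simp [siteReflect]

@[simp] theorem siteReflect_apply_ne (i : Fin d) (c : ZMod L) (x : Site d L) {k : Fin d} (h : k ≠ i) :
    siteReflect i c x k = x k := by
  simp [siteReflect, h]

@[simp] theorem siteReflect_siteReflect (i : Fin d) (c : ZMod L) (x : Site d L) :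
    siteReflect i c (siteReflect i c x) = x := by
  ext k
  by_cases h : k = i
  · subst h; simp
  · simp [h]

theorem siteReflect_shift_ne (i : Fin d) (c : ZMod L) (x : Site d L) {k : Fin d} (h : k ≠ i) :
    siteReflect i c (x.shift k) = (siteReflect i c x).shift k := by
  ext l
  by_cases hl : l = i
  · subst hl
    simp [Site.shift, Ne.symm h]
  · simp [Site.shift, hl]

theorem siteReflect_shift_self (i : Fin d) (c : ZMod L) (x : Site d L) :
    siteReflect i c (x.shift i) = siteReflect i c x - Pi.single i 1 := by
  ext l
  by_cases hl : l = i
  · subst hl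
    simp [Site.shift]; abel
  · simp [Site.shift, hl]

theorem siteReflect_sub_single (i : Fin d) (c : ZMod L) (x : Site d L) :
    siteReflect i c (x - Pi.single i 1) = siteReflect i c x + Pi.single i 1 := by
  ext l
  by_cases hl : l = i
  · subst hl
    simp; abel
  · simp [hl]

/-- `(θx - eᵢ).shift i = θ x`. -/
theorem sub_single_shift (i : Fin d) (y : Site d L) : (y - Pi.single i 1).shift i = y := by
  simp [Site.shift]

theorem sub_single_shift_ne (i : Fin d) (y : Site d L) {k : Fin d} (_h : k ≠ i) :
    (y - Pi.single i 1).shift k = y.shift k - Pi.single i 1 := by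
  simp [Site.shift]; abel

/-- The reflection on positively oriented links: a link in a direction `j ≠ i` goes to the link at the
reflected site; the link `x → x + eᵢ` goes to the link `θx - eᵢ → θx` (traversed backwards). -/
def edgeReflect (i : Fin d) (c : ZMod L) (e : Edge d L) : Edge d L :=
  if e.2 = i then (siteReflect i c e.1 - Pi.single i 1, i) else (siteReflect i c e.1, e.2)

theorem edgeReflect_edgeReflect (i : Fin d) (c : ZMod L) (e : Edge d L) :
    edgeReflect i c (edgeReflect i c e) = e := by
  obtain ⟨x, j⟩ := e
  unfold edgeReflect
  by_cases h : j = i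
  · subst h
    simp [siteReflect_sub_single]
  · simp [h]

/-- `edgeReflect` as a permutation of the links. -/
def edgeReflectEquiv (i : Fin d) (c : ZMod L) : Equiv.Perm (Edge d L) :=
  Function.Involutive.toPerm (edgeReflect i c) (edgeReflect_edgeReflect i c)

variable {G : Type*} [Group G]

/-- The reflection `Θ` on gauge configurations: relabel the links by `edgeReflect` and invert the
links in direction `i` (they are traversed backwards by the reflected plaquettes). -/
def configReflect (i : Fin d) (c : ZMod L) (U : GaugeConfig d L G) : GaugeConfig d L G :=
  fun e => if e.2 = i then (U (edgeReflect i c e))⁻¹ else U (edgeReflect i c e)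

theorem configReflect_apply_ne (i : Fin d) (c : ZMod L) (U : GaugeConfig d L G) (x : Site d L)
    {j : Fin d} (h : j ≠ i) : configReflect i c U (x, j) = U (siteReflect i c x, j) := by
  simp [configReflect, edgeReflect, h]

theorem configReflect_apply_self (i : Fin d) (c : ZMod L) (U : GaugeConfig d L G) (x : Site d L) :
    configReflect i c U (x, i) = (U (siteReflect i c x - Pi.single i 1, i))⁻¹ := by
  simp [configReflect, edgeReflect]

/-- The reflection on plaquettes: a plaquette in a plane not containing `eᵢ` goes to the plaquette at
the reflected base point; a plaquette in a plane containing `eᵢ` goes to the one based at `θx - eᵢ`. -/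
def plaqReflect (i : Fin d) (c : ZMod L) (p : Plaquette d L) : Plaquette d L :=
  (if p.2.1.1 = i ∨ p.2.1.2 = i then siteReflect i c p.1 - Pi.single i 1 else siteReflect i c p.1, p.2)

theorem plaqReflect_plaqReflect (i : Fin d) (c : ZMod L) (p : Plaquette d L) :
    plaqReflect i c (plaqReflect i c p) = p := by
  obtain ⟨x, jk⟩ := p
  unfold plaqReflect
  by_cases h : jk.1.1 = i ∨ jk.1.2 = i
  · simp [h, siteReflect_sub_single]
  · simp [h]

theorem plaqReflect_injective (i : Fin d) (c : ZMod L) : Function.Injective (plaqReflect i c) :=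
  (Function.Involutive.injective (plaqReflect_plaqReflect i c))

/-- Holonomy of a reflected configuration around a plaquette in a plane NOT containing `eᵢ`. -/
theorem plaquetteHolonomy_configReflect_of_ne (i : Fin d) (c : ZMod L) (U : GaugeConfig d L G)
    (x : Site d L) {j k : Fin d} (hj : j ≠ i) (hk : k ≠ i) :
    plaquetteHolonomy (configReflect i c U) x j k = plaquetteHolonomy U (siteReflect i c x) j k := by
  simp only [plaquetteHolonomy, configReflect_apply_ne _ _ _ _ hj, configReflect_apply_ne _ _ _ _ hk,
    siteReflect_shift_ne _ _ _ hj, siteReflect_shift_ne _ _ _ hk]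

/-- Holonomy of a reflected configuration around a plaquette `(x; i, k)`: the conjugate of the INVERSE
holonomy around the reflected plaquette. -/
theorem plaquetteHolonomy_configReflect_left (i : Fin d) (c : ZMod L) (U : GaugeConfig d L G)
    (x : Site d L) {k : Fin d} (hk : k ≠ i) :
    plaquetteHolonomy (configReflect i c U) x i k =
      (U (siteReflect i c x - Pi.single i 1, i))⁻¹ *
        (plaquetteHolonomy U (siteReflect i c x - Pi.single i 1) i k)⁻¹ *
        U (siteReflect i c x - Pi.single i 1, i) := by
  simp only [plaquetteHolonomy, configReflect_apply_ne _ _ _ _ hk, configReflect_apply_self,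
    siteReflect_shift_ne _ _ _ hk, siteReflect_shift_self, sub_single_shift, sub_single_shift_ne _ _ hk]
  group

/-- Holonomy of a reflected configuration around a plaquette `(x; j, i)`. -/
theorem plaquetteHolonomy_configReflect_right (i : Fin d) (c : ZMod L) (U : GaugeConfig d L G)
    (x : Site d L) {j : Fin d} (hj : j ≠ i) :
    plaquetteHolonomy (configReflect i c U) x j i =
      (U (siteReflect i c x - Pi.single i 1, i))⁻¹ *
        (plaquetteHolonomy U (siteReflect i c x - Pi.single i 1) j i)⁻¹ *
        U (siteReflect i c x - Pi.single i 1, i) := by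
  simp only [plaquetteHolonomy, configReflect_apply_ne _ _ _ _ hj, configReflect_apply_self,
    siteReflect_shift_ne _ _ _ hj, siteReflect_shift_self, sub_single_shift, sub_single_shift_ne _ _ hj]
  group

variable {N : ℕ} [TopologicalSpace G] [IsTopologicalGroup G] [CompactSpace G]
variable (ρ : G →* Matrix (Fin N) (Fin N) ℂ)

/-- `Re tr ρ(a⁻¹ g⁻¹ a) = Re tr ρ(g)` for a continuous representation of a compact group. -/
theorem re_trace_conj_inv (hρ : Continuous ρ) (a g : G) :
    ((ρ (a⁻¹ * g⁻¹ * a)).trace).re = ((ρ g).trace).re := by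
  have h := Literature.RepresentationTheory.CompactGroups.CompactGroup.trace_conj_eq ρ g⁻¹ a⁻¹
  rw [inv_inv] at h
  rw [h, Literature.RepresentationTheory.CompactGroups.CompactGroup.re_trace_map_inv ρ hρ]

/-- **Transport of the plaquette cost under the reflection**: `S_p(ΘU) = S_{θp}(U)` (characters of
compact groups are real on inverses and class functions). -/
theorem plaquetteCost_configReflect [NeZero L] (hρ : Continuous ρ) (i : Fin d) (c : ZMod L)
    (U : GaugeConfig d L G) (p : Plaquette d L) :
    plaquetteCost ρ (configReflect i c U) p = plaquetteCost ρ U (plaqReflect i c p) := by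
  obtain ⟨x, ⟨⟨j, k⟩, hjk⟩⟩ := p
  unfold plaquetteCost plaqReflect
  simp only
  by_cases hj : j = i
  · subst hj
    have hk : k ≠ j := fun h => by simp [h] at hjk
    rw [if_pos (Or.inl rfl), plaquetteHolonomy_configReflect_left _ _ _ _ hk, re_trace_conj_inv ρ hρ]
  · by_cases hk : k = i
    · subst hk
      rw [if_pos (Or.inr rfl), plaquetteHolonomy_configReflect_right _ _ _ _ hj, re_trace_conj_inv ρ hρ]
    · rw [if_neg (by tauto), plaquetteHolonomy_configReflect_of_ne _ _ _ _ hj hk]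

end TorusGeometry

/-! ## §2 Heights above the reflection plane; the positive links `P` and the in-plane links `M` -/

section TorusRP

variable {d L : ℕ} [NeZero L]

/-- The height of a site above the lattice hyperplane `x_i = c`, read in `[0, L)`. -/
def ht (i : Fin d) (c : ZMod L) (x : Site d L) : ℕ := (x i - c).val

omit [NeZero L] in
theorem ht_eq_zero_iff (i : Fin d) (c : ZMod L) (x : Site d L) : ht i c x = 0 ↔ x i = c := by
  rw [ht, ZMod.val_eq_zero, sub_eq_zero]

theorem ht_lt (i : Fin d) (c : ZMod L) (x : Site d L) : ht i c x < L := ZMod.val_lt _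

omit [NeZero L] in
theorem ht_shift_ne (i : Fin d) (c : ZMod L) (x : Site d L) {k : Fin d} (h : k ≠ i) :
    ht i c (x.shift k) = ht i c x := by
  simp [ht, Site.shift, Ne.symm h]

theorem ht_shift_self (i : Fin d) (c : ZMod L) (x : Site d L) (hx : ht i c x + 1 < L) :
    ht i c (x.shift i) = ht i c x + 1 := by
  haveI : Fact (1 < L) := ⟨by omega⟩
  have h1 : (x.shift i) i - c = (x i - c) + 1 := by simp [Site.shift]; abel
  unfold ht at hx ⊢
  rw [h1, ZMod.val_add, ZMod.val_one, Nat.mod_eq_of_lt hx]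

theorem ht_siteReflect (i : Fin d) (c : ZMod L) (x : Site d L) (hx : ht i c x ≠ 0) :
    ht i c (siteReflect i c x) = L - ht i c x := by
  have h1 : siteReflect i c x i - c = -(x i - c) := by simp; abel
  have hx' : x i - c ≠ 0 := fun h => hx (by rw [ht, h, ZMod.val_zero])
  unfold ht
  rw [h1, ZMod.neg_val, if_neg hx']

theorem ht_siteReflect_sub_single (i : Fin d) (c : ZMod L) (x : Site d L) (hx : ht i c x + 1 < L) :
    ht i c (siteReflect i c x - Pi.single i 1) = L - (ht i c x + 1) := by
  haveI : Fact (1 < L) := ⟨by omega⟩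
  have h1 : (siteReflect i c x - Pi.single i 1 : Site d L) i - c = -((x i - c) + 1) := by simp; abel
  have hv : ((x i - c) + 1 : ZMod L).val = ht i c x + 1 := by
    unfold ht at hx ⊢; rw [ZMod.val_add, ZMod.val_one, Nat.mod_eq_of_lt hx]
  have hne : ((x i - c) + 1 : ZMod L) ≠ 0 := fun h => by
    rw [h, ZMod.val_zero] at hv; omega
  show ((siteReflect i c x - Pi.single i 1 : Site d L) i - c).val = L - (ht i c x + 1)
  rw [h1, ZMod.neg_val, if_neg hne, hv]

omit [NeZero L] in
theorem siteReflect_eq_self_of_ht (i : Fin d) (c : ZMod L) (x : Site d L) (hx : ht i c x = 0) :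
    siteReflect i c x = x := by
  rw [ht_eq_zero_iff] at hx
  ext k
  by_cases h : k = i
  · subst h; simp [hx]
  · simp [h]

/-- The POSITIVE links: links in directions `≠ i` at heights `1 … H`, and links in direction `i`
starting at heights `0 … H-1`. -/
def posEdges (i : Fin d) (c : ZMod L) (H : ℕ) : Finset (Edge d L) :=
  univ.filter fun e => (e.2 ≠ i ∧ 1 ≤ ht i c e.1 ∧ ht i c e.1 ≤ H) ∨ (e.2 = i ∧ ht i c e.1 + 1 ≤ H)

/-- The IN-PLANE links: links in directions `≠ i` at height `0` (fixed by the reflection). -/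
def planeEdges (i : Fin d) (c : ZMod L) : Finset (Edge d L) :=
  univ.filter fun e => e.2 ≠ i ∧ ht i c e.1 = 0

theorem mem_posEdges {i : Fin d} {c : ZMod L} {H : ℕ} {e : Edge d L} :
    e ∈ posEdges i c H ↔ (e.2 ≠ i ∧ 1 ≤ ht i c e.1 ∧ ht i c e.1 ≤ H) ∨ (e.2 = i ∧ ht i c e.1 + 1 ≤ H) := by
  simp [posEdges]

theorem mem_planeEdges {i : Fin d} {c : ZMod L} {e : Edge d L} :
    e ∈ planeEdges i c ↔ e.2 ≠ i ∧ ht i c e.1 = 0 := by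
  simp [planeEdges]

theorem disjoint_planeEdges_posEdges (i : Fin d) (c : ZMod L) (H : ℕ) :
    Disjoint (planeEdges i c) (posEdges i c H) := by
  rw [Finset.disjoint_left]
  intro e he hp
  rw [mem_planeEdges] at he
  rw [mem_posEdges] at hp
  omega

/-- The reflection of a positive link is not positive (it lies strictly below the plane). -/
theorem edgeReflect_not_mem_posEdges {i : Fin d} {c : ZMod L} {H : ℕ} (hH : 2 * H < L) {e : Edge d L}
    (he : e ∈ posEdges i c H) : edgeReflect i c e ∉ posEdges i c H := by
  obtain ⟨x, j⟩ := e
  rw [mem_posEdges] at he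
  intro hmem
  rw [mem_posEdges] at hmem
  unfold edgeReflect at hmem
  by_cases hj : j = i
  · subst hj
    simp only [if_true] at hmem
    have ht0 : ht j c x + 1 ≤ H := by
      rcases he with h | h
      · exact absurd rfl h.1
      · exact h.2
    rw [ht_siteReflect_sub_single j c x (by omega)] at hmem
    omega
  · simp only [hj, if_false] at hmem
    have ht0 : 1 ≤ ht i c x ∧ ht i c x ≤ H := by
      rcases he with h | h
      · exact h.2
      · exact absurd h.1 hj
    rw [ht_siteReflect i c x (by omega)] at hmem
    omega

variable {G : Type*} [Group G]

/-- `Θ` fixes the in-plane links. -/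
theorem configReflect_apply_of_mem_planeEdges (i : Fin d) (c : ZMod L) (U : GaugeConfig d L G)
    {e : Edge d L} (he : e ∈ planeEdges i c) : configReflect i c U e = U e := by
  obtain ⟨x, j⟩ := e
  rw [mem_planeEdges] at he
  rw [configReflect_apply_ne _ _ _ _ he.1, siteReflect_eq_self_of_ht _ _ _ he.2]

/-- The positive coordinates of `Θ U` depend only on the coordinates of `U` off `P`. -/
theorem dependsOn_configReflect {i : Fin d} {c : ZMod L} {H : ℕ} (hH : 2 * H < L) {e : Edge d L}
    (he : e ∈ posEdges i c H ∪ ∅) :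
    DependsOn (fun U : GaugeConfig d L G => configReflect i c U e) (((posEdges i c H)ᶜ : Finset (Edge d L)) : Set (Edge d L)) := by
  rw [Finset.union_empty] at he
  have hmem : edgeReflect i c e ∈ (((posEdges i c H)ᶜ : Finset (Edge d L)) : Set (Edge d L)) :=
    Finset.mem_coe.2 (Finset.mem_compl.2 (edgeReflect_not_mem_posEdges hH he))
  intro U V hUV
  simp only [configReflect]
  rw [hUV _ hmem]

variable [MeasurableSpace G] [TopologicalSpace G] [IsTopologicalGroup G] [CompactSpace G] [BorelSpace G]

/-- **`Θ` preserves the product Haar measure** (relabelling of the links by an involution and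
inversion of the links in direction `i`; Haar measure is inversion invariant). -/
theorem measurePreserving_configReflect (i : Fin d) (c : ZMod L) :
    MeasurePreserving (configReflect i c : GaugeConfig d L G → GaugeConfig d L G)
      (LatticeRP.piMeasure (haarProbability G)) (LatticeRP.piMeasure (haarProbability G)) := by
  have h1 : MeasurePreserving
      (MeasurableEquiv.arrowCongr' (edgeReflectEquiv (d := d) (L := L) i c) (MeasurableEquiv.refl G))
      (LatticeRP.piMeasure (haarProbability G)) (LatticeRP.piMeasure (haarProbability G)) :=
    measurePreserving_arrowCongr' (fun _ => haarProbability G) (fun _ => haarProbability G)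
      (edgeReflectEquiv i c) (MeasurableEquiv.refl G) fun _ => MeasurePreserving.id _
  have h2 : MeasurePreserving
      (fun (V : GaugeConfig d L G) (e : Edge d L) =>
        (if e.2 = i then (fun g : G => g⁻¹) else id) (V e))
      (LatticeRP.piMeasure (haarProbability G)) (LatticeRP.piMeasure (haarProbability G)) := by
    refine measurePreserving_pi _ _ fun e => ?_
    split_ifs
    · exact Measure.measurePreserving_inv _
    · exact MeasurePreserving.id _
  have heq : (configReflect i c : GaugeConfig d L G → GaugeConfig d L G) =
      (fun (V : GaugeConfig d L G) (e : Edge d L) =>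
        (if e.2 = i then (fun g : G => g⁻¹) else id) (V e)) ∘
      (MeasurableEquiv.arrowCongr' (edgeReflectEquiv (d := d) (L := L) i c) (MeasurableEquiv.refl G)) := by
    funext U e
    have happ : (MeasurableEquiv.arrowCongr' (edgeReflectEquiv (d := d) (L := L) i c)
        (MeasurableEquiv.refl G)) U e = U (edgeReflect i c e) := rfl
    simp only [Function.comp_apply, configReflect, happ]
    split_ifs <;> rfl
  rw [heq]
  exact h2.comp h1

end TorusRP

/-! ## §3 The half-weighted Boltzmann factor and the doubling inequality on the torus -/

section TorusDoubling

open scoped Classical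

variable {d L : ℕ} [NeZero L]

/-- The plaquette lies in a plane containing the direction `i`. -/
def Touches (i : Fin d) (p : Plaquette d L) : Prop := p.2.1.1 = i ∨ p.2.1.2 = i

/-- UPPER plaquettes of range `H`: all links at heights `0 … H` (positive or in-plane). -/
def IsUpper (i : Fin d) (c : ZMod L) (H : ℕ) (p : Plaquette d L) : Prop :=
  (¬ Touches i p ∧ ht i c p.1 ≤ H) ∨ (Touches i p ∧ ht i c p.1 + 1 ≤ H)

/-- FACE plaquettes: those lying in the reflection plane (fixed by the reflection). -/
def IsFace (i : Fin d) (c : ZMod L) (p : Plaquette d L) : Prop := ¬ Touches i p ∧ ht i c p.1 = 0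

omit [NeZero L] in
theorem plaqReflect_of_isFace {i : Fin d} {c : ZMod L} {p : Plaquette d L} (hp : IsFace i c p) :
    plaqReflect i c p = p := by
  obtain ⟨x, jk⟩ := p
  obtain ⟨hnt, h0⟩ := hp
  unfold plaqReflect
  rw [if_neg (by exact hnt), siteReflect_eq_self_of_ht _ _ _ h0]

/-- The reflection of an upper non-face plaquette is not upper (it lies strictly below the plane). -/
theorem not_isUpper_plaqReflect {i : Fin d} {c : ZMod L} {H : ℕ} (hH : 2 * H < L) {p : Plaquette d L}
    (hp : IsUpper i c H p) (hnf : ¬ IsFace i c p) : ¬ IsUpper i c H (plaqReflect i c p) := by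
  obtain ⟨x, jk⟩ := p
  unfold IsUpper IsFace Touches plaqReflect at *
  simp only at hp hnf ⊢
  by_cases ht0 : jk.1.1 = i ∨ jk.1.2 = i
  · rw [if_pos ht0]
    have h1 : ht i c x + 1 ≤ H := by tauto
    rw [ht_siteReflect_sub_single i c x (by omega)]
    omega
  · rw [if_neg ht0]
    have h1 : ht i c x ≤ H := by tauto
    have h2 : ht i c x ≠ 0 := by tauto
    rw [ht_siteReflect i c x h2]
    omega

variable {G : Type*} [Group G]

theorem mem_PM_of_ne {i : Fin d} {c : ZMod L} {H : ℕ} {y : Site d L} {j : Fin d} (hj : j ≠ i)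
    (hy : ht i c y ≤ H) : (y, j) ∈ posEdges i c H ∪ planeEdges i c := by
  rw [Finset.mem_union, mem_posEdges, mem_planeEdges]
  rcases Nat.eq_zero_or_pos (ht i c y) with h0 | h0
  · exact Or.inr ⟨hj, h0⟩
  · exact Or.inl (Or.inl ⟨hj, h0, hy⟩)

theorem mem_PM_of_eq {i : Fin d} {c : ZMod L} {H : ℕ} {y : Site d L} (hy : ht i c y + 1 ≤ H) :
    (y, i) ∈ posEdges i c H ∪ planeEdges i c := by
  rw [Finset.mem_union, mem_posEdges]
  exact Or.inl (Or.inr ⟨rfl, hy⟩)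

/-- The holonomy of an upper plaquette depends only on the positive and in-plane links. -/
theorem plaquetteHolonomy_eq_of_isUpper {i : Fin d} {c : ZMod L} {H : ℕ} (hH : 2 * H < L)
    {p : Plaquette d L} (hp : IsUpper i c H p) {U V : GaugeConfig d L G}
    (hUV : ∀ e ∈ ((posEdges i c H ∪ ∅ ∪ planeEdges i c : Finset (Edge d L)) : Set (Edge d L)), U e = V e) :
    plaquetteHolonomy U p.1 p.2.1.1 p.2.1.2 = plaquetteHolonomy V p.1 p.2.1.1 p.2.1.2 := by
  rw [Finset.union_empty] at hUV
  have hUV' : ∀ e ∈ posEdges i c H ∪ planeEdges i c, U e = V e := fun e he => hUV e (Finset.mem_coe.2 he)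
  obtain ⟨x, ⟨⟨j, k⟩, hjk⟩⟩ := p
  unfold IsUpper Touches at hp
  simp only at hp ⊢
  simp only [plaquetteHolonomy]
  by_cases hj : j = i
  · subst hj
    have hk : k ≠ j := fun h => by simp [h] at hjk
    have h1 : ht j c x + 1 ≤ H := by tauto
    rw [hUV' _ (mem_PM_of_eq h1),
      hUV' _ (mem_PM_of_ne hk (by rw [ht_shift_self j c x (by omega)]; exact h1)),
      hUV' _ (mem_PM_of_eq (by rw [ht_shift_ne j c x hk]; exact h1)),
      hUV' _ (mem_PM_of_ne hk (by omega))]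
  · by_cases hk : k = i
    · subst hk
      have h1 : ht k c x + 1 ≤ H := by tauto
      rw [hUV' _ (mem_PM_of_ne hj (by omega)),
        hUV' _ (mem_PM_of_eq (by rw [ht_shift_ne k c x hj]; exact h1)),
        hUV' _ (mem_PM_of_ne hj (by rw [ht_shift_self k c x (by omega)]; exact h1)),
        hUV' _ (mem_PM_of_eq h1)]
    · have h1 : ht i c x ≤ H := by tauto
      rw [hUV' _ (mem_PM_of_ne hj h1),
        hUV' _ (mem_PM_of_ne hk (by rw [ht_shift_ne i c x hj]; exact h1)),
        hUV' _ (mem_PM_of_ne hj (by rw [ht_shift_ne i c x hk]; exact h1)),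
        hUV' _ (mem_PM_of_ne hk h1)]

variable {N : ℕ} [TopologicalSpace G] [IsTopologicalGroup G] [CompactSpace G] [MeasurableSpace G] [BorelSpace G]
variable (ρ : G →* Matrix (Fin N) (Fin N) ℂ) (β : ℝ)

/-- The torus Boltzmann weight of one plaquette. -/
def tw (p : Plaquette d L) (U : GaugeConfig d L G) : ℝ := Real.exp (-β * plaquetteCost ρ U p)

/-- The HALF-WEIGHTED Boltzmann factor of a set of plaquettes: face plaquettes carry `w_p^{1/2}`. -/
def halfWeight (i : Fin d) (c : ZMod L) (A : Finset (Plaquette d L)) (U : GaugeConfig d L G) : ℝ :=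
  ∏ p ∈ A, if IsFace i c p then Real.sqrt (tw ρ β p U) else tw ρ β p U

omit [NeZero L] [TopologicalSpace G] [IsTopologicalGroup G] [CompactSpace G] [MeasurableSpace G] [BorelSpace G] in
theorem tw_pos [NeZero L] (p : Plaquette d L) (U : GaugeConfig d L G) : 0 < tw ρ β p U := Real.exp_pos _

omit [NeZero L] [TopologicalSpace G] [IsTopologicalGroup G] [CompactSpace G] [MeasurableSpace G] [BorelSpace G] in
theorem tw_le_one [NeZero L] (hρN : ∀ g, (ρ g).trace.re ≤ N) (hβ : 0 ≤ β) (p : Plaquette d L) (U : GaugeConfig d L G) :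
    tw ρ β p U ≤ 1 := by
  unfold tw
  rw [Real.exp_le_one_iff]
  have : 0 ≤ plaquetteCost ρ U p := by
    unfold plaquetteCost; linarith [hρN (plaquetteHolonomy U p.1 p.2.1.1 p.2.1.2)]
  nlinarith

omit [NeZero L] [CompactSpace G] [MeasurableSpace G] [BorelSpace G] in
theorem continuous_tw [NeZero L] (hρ : Continuous ρ) (p : Plaquette d L) :
    Continuous fun U : GaugeConfig d L G => tw ρ β p U := by
  unfold tw plaquetteCost
  have h1 : Continuous fun U : GaugeConfig d L G => plaquetteHolonomy U p.1 p.2.1.1 p.2.1.2 := by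
    unfold plaquetteHolonomy; fun_prop
  have h2 : Continuous fun U : GaugeConfig d L G =>
      (ρ (plaquetteHolonomy U p.1 p.2.1.1 p.2.1.2)).trace.re :=
    Complex.continuous_re.comp (hρ.comp h1).matrix_trace
  exact Real.continuous_exp.comp (continuous_const.mul (continuous_const.sub h2))

omit [CompactSpace G] [MeasurableSpace G] [BorelSpace G] in
theorem continuous_prod_tw (hρ : Continuous ρ) (A : Finset (Plaquette d L)) :
    Continuous fun U : GaugeConfig d L G => ∏ p ∈ A, tw ρ β p U :=
  continuous_finsetProd _ fun p _ => continuous_tw ρ β hρ p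

omit [CompactSpace G] [MeasurableSpace G] [BorelSpace G] in
theorem continuous_halfWeight (hρ : Continuous ρ) (i : Fin d) (c : ZMod L) (A : Finset (Plaquette d L)) :
    Continuous fun U : GaugeConfig d L G => halfWeight ρ β i c A U := by
  unfold halfWeight
  refine continuous_finsetProd _ fun p _ => ?_
  by_cases hf : IsFace i c p
  · simp only [hf, if_true]; exact (continuous_tw ρ β hρ p).sqrt
  · simp only [hf, if_false]; exact continuous_tw ρ β hρ p

omit [TopologicalSpace G] [IsTopologicalGroup G] [CompactSpace G] [MeasurableSpace G] [BorelSpace G] in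
theorem halfWeight_nonneg (i : Fin d) (c : ZMod L) (A : Finset (Plaquette d L)) (U : GaugeConfig d L G) :
    0 ≤ halfWeight ρ β i c A U := by
  unfold halfWeight
  refine prod_nonneg fun p _ => ?_
  by_cases hf : IsFace i c p
  · rw [if_pos hf]; exact Real.sqrt_nonneg _
  · rw [if_neg hf]; exact (tw_pos ρ β p U).le

omit [TopologicalSpace G] [IsTopologicalGroup G] [CompactSpace G] [MeasurableSpace G] [BorelSpace G] in
theorem halfWeight_le_one (hρN : ∀ g, (ρ g).trace.re ≤ N) (hβ : 0 ≤ β) (i : Fin d) (c : ZMod L)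
    (A : Finset (Plaquette d L)) (U : GaugeConfig d L G) : halfWeight ρ β i c A U ≤ 1 := by
  unfold halfWeight
  refine prod_le_one (fun p _ => ?_) (fun p _ => ?_)
  · by_cases hf : IsFace i c p
    · rw [if_pos hf]; exact Real.sqrt_nonneg _
    · rw [if_neg hf]; exact (tw_pos ρ β p U).le
  · by_cases hf : IsFace i c p
    · rw [if_pos hf]; exact (Real.sqrt_le_sqrt (tw_le_one ρ β hρN hβ p U)).trans_eq Real.sqrt_one
    · rw [if_neg hf]; exact tw_le_one ρ β hρN hβ p U

omit [TopologicalSpace G] [IsTopologicalGroup G] [CompactSpace G] [MeasurableSpace G] [BorelSpace G] in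
/-- `∏_{p ∈ A} w_p ≤ halfWeight` (`w ≤ √w` on `[0, 1]`). -/
theorem prod_tw_le_halfWeight (hρN : ∀ g, (ρ g).trace.re ≤ N) (hβ : 0 ≤ β) (i : Fin d) (c : ZMod L)
    (A : Finset (Plaquette d L)) (U : GaugeConfig d L G) :
    ∏ p ∈ A, tw ρ β p U ≤ halfWeight ρ β i c A U := by
  unfold halfWeight
  refine prod_le_prod (fun p _ => (tw_pos ρ β p U).le) fun p _ => ?_
  by_cases hf : IsFace i c p
  · rw [if_pos hf]
    calc tw ρ β p U = Real.sqrt ((tw ρ β p U) ^ 2) := (Real.sqrt_sq (tw_pos ρ β p U).le).symm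
      _ ≤ Real.sqrt (tw ρ β p U) :=
          Real.sqrt_le_sqrt (by nlinarith [tw_pos ρ β p U, tw_le_one ρ β hρN hβ p U])
  · rw [if_neg hf]

omit [MeasurableSpace G] [BorelSpace G] in
/-- The weight of a reflected configuration is the weight of the reflected plaquette. -/
theorem tw_configReflect (hρ : Continuous ρ) (i : Fin d) (c : ZMod L) (p : Plaquette d L) (U : GaugeConfig d L G) :
    tw ρ β p (configReflect i c U) = tw ρ β (plaqReflect i c p) U := by
  unfold tw; rw [plaquetteCost_configReflect ρ hρ]

omit [MeasurableSpace G] [BorelSpace G] in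
/-- **`F · (F ∘ Θ)` is the full Boltzmann weight of the doubled set** `A ∪ θ(A ∖ faces)`. -/
theorem halfWeight_mul_halfWeight_configReflect (hρ : Continuous ρ) {i : Fin d} {c : ZMod L} {H : ℕ}
    (hH : 2 * H < L) {A : Finset (Plaquette d L)} (hA : ∀ p ∈ A, IsUpper i c H p) (U : GaugeConfig d L G) :
    halfWeight ρ β i c A U * halfWeight ρ β i c A (configReflect i c U) =
      ∏ p ∈ A ∪ (A.filter fun p => ¬ IsFace i c p).image (plaqReflect i c), tw ρ β p U := by
  have hdisj : Disjoint A ((A.filter fun p => ¬ IsFace i c p).image (plaqReflect i c)) := by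
    rw [Finset.disjoint_left]
    intro q hq hq'
    obtain ⟨p, hp, rfl⟩ := Finset.mem_image.1 hq'
    rw [Finset.mem_filter] at hp
    exact not_isUpper_plaqReflect hH (hA p hp.1) hp.2 (hA _ hq)
  rw [prod_union hdisj, prod_image fun p _ q _ h => plaqReflect_injective i c h, prod_filter,
    halfWeight, halfWeight, ← prod_mul_distrib, ← prod_mul_distrib]
  refine prod_congr rfl fun p _ => ?_
  by_cases hf : IsFace i c p
  · simp only [hf, not_true_eq_false, if_true, if_false, tw_configReflect ρ β hρ, plaqReflect_of_isFace hf,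
      mul_one]
    exact Real.mul_self_sqrt (tw_pos ρ β p U).le
  · simp only [hf, not_false_eq_true, if_true, if_false, tw_configReflect ρ β hρ]

variable [SecondCountableTopology G]

omit [NeZero L] in
theorem splice_empty {ι X : Type*} [DecidableEq ι] (p : (ι → X) × (ι → X)) :
    LatticeRP.splice (∅ : Finset ι) p = p.1 := by
  funext j; simp [LatticeRP.splice_apply]

/-- **Reflection positivity through sites, Schwarz form**: `(∫ F)² ≤ ∫ F · (F ∘ Θ)` for the
half-weighted Boltzmann factor of a set of upper plaquettes. -/
theorem sq_integral_halfWeight_le (hρ : Continuous ρ) (hρN : ∀ g, (ρ g).trace.re ≤ N) (hβ : 0 ≤ β)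
    {i : Fin d} {c : ZMod L} {H : ℕ} (hH : 2 * H < L) {A : Finset (Plaquette d L)}
    (hA : ∀ p ∈ A, IsUpper i c H p) :
    (∫ U, halfWeight ρ β i c A U ∂(LatticeRP.piMeasure (haarProbability G))) ^ 2 ≤
      ∫ U, halfWeight ρ β i c A U * halfWeight ρ β i c A (configReflect i c U)
        ∂(LatticeRP.piMeasure (haarProbability G)) := by
  set μ : Measure (GaugeConfig d L G) := LatticeRP.piMeasure (haarProbability G) with hμ
  set Φ : GaugeConfig d L G → ℂ := fun U => (halfWeight ρ β i c A U : ℂ) with hΦ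
  have hΦm : Measurable Φ := (Complex.continuous_ofReal.comp (continuous_halfWeight ρ β hρ i c A)).measurable
  have hΦb : ∀ U, ‖Φ U‖ ≤ 1 := fun U => by
    rw [hΦ]; dsimp only
    rw [Complex.norm_real, Real.norm_of_nonneg (halfWeight_nonneg ρ β i c A U)]
    exact halfWeight_le_one ρ β hρN hβ i c A U
  have hΦdep : DependsOn Φ ((posEdges i c H ∪ ∅ ∪ planeEdges i c : Finset (Edge d L)) : Set (Edge d L)) := by
    intro U V hUV
    rw [hΦ]; dsimp only
    congr 1
    unfold halfWeight
    refine prod_congr rfl fun p hp => ?_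
    have h := plaquetteHolonomy_eq_of_isUpper (G := G) hH (hA p hp) hUV
    simp only [tw, plaquetteCost, h]
  have key := (LatticeRP.re_sum_pair_sq_le (haarProbability G) (∅ : Finset (Edge d L)) (configReflect i c)
    (I := Empty) (fun _ _ => (0 : ℂ)) (planeEdges i c) (posEdges i c H)
    (measurePreserving_configReflect i c) (fun U e he => configReflect_apply_of_mem_planeEdges i c U he)
    (fun e he => dependsOn_configReflect hH he) (disjoint_planeEdges_posEdges i c H)
    (Finset.disjoint_empty_right _) (fun _ => measurable_const) (Ka := 0) (fun _ _ => by simp)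
    (fun k => Empty.elim k) (κ := Unit) (Φ := fun _ => Φ) (Ψ := fun _ _ => (1 : ℂ))
    (fun _ => hΦm) (fun _ => measurable_const) (KΦ := 1) (KΨ := 1) (fun _ U => hΦb U)
    (fun _ _ => by simp) (fun _ => hΦdep) (fun _ _ _ _ => rfl)).2
  simp only [splice_empty, Finset.univ_unique, Finset.sum_singleton, Finset.univ_eq_empty,
    Finset.sum_empty, Complex.exp_zero, mul_one, map_one] at key
  rw [integral_fun_fst (fun U => Φ U), integral_fun_fst (fun U => Φ U * conj (Φ (configReflect i c U))),
    integral_const] at key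
  simp only [probReal_univ, one_smul, Complex.one_re, mul_one] at key
  have e1 : (∫ U, Φ U ∂μ) = ((∫ U, halfWeight ρ β i c A U ∂μ : ℝ) : ℂ) := by
    rw [hΦ]; exact integral_complex_ofReal
  have e2 : (∫ U, Φ U * conj (Φ (configReflect i c U)) ∂μ) =
      ((∫ U, halfWeight ρ β i c A U * halfWeight ρ β i c A (configReflect i c U) ∂μ : ℝ) : ℂ) := by
    rw [hΦ]; dsimp only
    simp_rw [Complex.conj_ofReal, ← Complex.ofReal_mul]
    exact integral_complex_ofReal
  rw [e1, e2, Complex.ofReal_re, Complex.ofReal_re] at key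
  exact key

/-- **The doubling inequality on the torus**: for a set `A` of upper plaquettes,
`(∫ ∏_{A} w)² ≤ ∫ ∏_{A ∪ θ(A ∖ faces)} w` (product Haar measure, `β ≥ 0`). -/
theorem sq_integral_prod_tw_le (hρ : Continuous ρ) (hρN : ∀ g, (ρ g).trace.re ≤ N) (hβ : 0 ≤ β)
    {i : Fin d} {c : ZMod L} {H : ℕ} (hH : 2 * H < L) {A : Finset (Plaquette d L)}
    (hA : ∀ p ∈ A, IsUpper i c H p) :
    (∫ U, ∏ p ∈ A, tw ρ β p U ∂(Measure.pi fun _ : Edge d L => haarProbability G)) ^ 2 ≤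
      ∫ U, ∏ p ∈ A ∪ (A.filter fun p => ¬ IsFace i c p).image (plaqReflect i c), tw ρ β p U
        ∂(Measure.pi fun _ : Edge d L => haarProbability G) := by
  have h1 : (∫ U, ∏ p ∈ A, tw ρ β p U ∂(Measure.pi fun _ : Edge d L => haarProbability G)) ≤
      ∫ U, halfWeight ρ β i c A U ∂(Measure.pi fun _ : Edge d L => haarProbability G) :=
    integral_mono ((continuous_prod_tw ρ β hρ A).integrable_of_hasCompactSupport (HasCompactSupport.of_compactSpace _))
      ((continuous_halfWeight ρ β hρ i c A).integrable_of_hasCompactSupport (HasCompactSupport.of_compactSpace _))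
      fun U => prod_tw_le_halfWeight ρ β hρN hβ i c A U
  have h0 : 0 ≤ ∫ U, ∏ p ∈ A, tw ρ β p U ∂(Measure.pi fun _ : Edge d L => haarProbability G) :=
    integral_nonneg fun U => prod_nonneg fun p _ => (tw_pos ρ β p U).le
  have h2 := sq_integral_halfWeight_le ρ β hρ hρN hβ hH hA
  simp_rw [halfWeight_mul_halfWeight_configReflect ρ β hρ hH hA] at h2
  calc (∫ U, ∏ p ∈ A, tw ρ β p U ∂(Measure.pi fun _ : Edge d L => haarProbability G)) ^ 2
      ≤ (∫ U, halfWeight ρ β i c A U ∂(Measure.pi fun _ : Edge d L => haarProbability G)) ^ 2 :=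
        pow_le_pow_left₀ h0 h1 2
    _ ≤ _ := h2

end TorusDoubling

/-! ## §4 Transfer to `ℤ^d`: the doubling inequality for free-boundary partition functions -/

section Zd

open scoped Classical
open Literature.Probability.LatticeModels (halfOpenBox Torus.proj)

variable {d : ℕ}

/-- Reflection of `ℤ^d` in the lattice hyperplane `x_i = c₀`. -/
def zReflect (i : Fin d) (c₀ : ℤ) (x : Fin d → ℤ) : Fin d → ℤ := Function.update x i (c₀ + c₀ - x i)

/-- The plaquette lies in a plane containing `eᵢ`. -/
def ZTouches (i : Fin d) (p : ZdPlaquette d) : Prop := p.2.1.1 = i ∨ p.2.1.2 = i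

/-- Reflection of plaquettes of `ℤ^d` in the hyperplane `x_i = c₀`. -/
def zPlaqReflect (i : Fin d) (c₀ : ℤ) (p : ZdPlaquette d) : ZdPlaquette d :=
  (if ZTouches i p then zReflect i c₀ p.1 - Pi.single i 1 else zReflect i c₀ p.1, p.2)

/-- Upper plaquettes of range `H` above the hyperplane `x_i = c₀`. -/
def ZIsUpper (i : Fin d) (c₀ : ℤ) (H : ℕ) (p : ZdPlaquette d) : Prop :=
  (¬ ZTouches i p ∧ c₀ ≤ p.1 i ∧ p.1 i ≤ c₀ + H) ∨ (ZTouches i p ∧ c₀ ≤ p.1 i ∧ p.1 i + 1 ≤ c₀ + H)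

/-- Face plaquettes: those inside the hyperplane `x_i = c₀`. -/
def ZIsFace (i : Fin d) (c₀ : ℤ) (p : ZdPlaquette d) : Prop := ¬ ZTouches i p ∧ p.1 i = c₀

/-- The DOUBLED set `A ∪ θ(A ∖ faces)`. -/
def zDouble (i : Fin d) (c₀ : ℤ) (I : Finset (ZdPlaquette d)) : Finset (ZdPlaquette d) :=
  I ∪ (I.filter fun p => ¬ ZIsFace i c₀ p).image (zPlaqReflect i c₀)

/-- The torus plaquette below a plaquette of `ℤ^d`. -/
def toT (L : ℕ) (p : ZdPlaquette d) : Plaquette d L := (Torus.proj L p.1, p.2)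

theorem proj_zReflect (L : ℕ) (i : Fin d) (c₀ : ℤ) (x : Fin d → ℤ) :
    Torus.proj L (zReflect i c₀ x) = siteReflect i (c₀ : ZMod L) (Torus.proj L x) := by
  ext k
  by_cases hk : k = i
  · subst hk; simp [Torus.proj, zReflect]
  · simp [Torus.proj, zReflect, hk]

theorem proj_sub_single (L : ℕ) (i : Fin d) (x : Fin d → ℤ) :
    Torus.proj L (x - Pi.single i 1) = Torus.proj L x - Pi.single i 1 := by
  ext k
  by_cases hk : k = i
  · subst hk; simp [Torus.proj]
  · simp [Torus.proj, hk]

theorem toT_zPlaqReflect (L : ℕ) (i : Fin d) (c₀ : ℤ) (p : ZdPlaquette d) :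
    toT L (zPlaqReflect i c₀ p) = plaqReflect i (c₀ : ZMod L) (toT L p) := by
  unfold toT zPlaqReflect plaqReflect ZTouches
  by_cases h : p.2.1.1 = i ∨ p.2.1.2 = i
  · rw [if_pos h, if_pos h, proj_sub_single, proj_zReflect]
  · rw [if_neg h, if_neg h, proj_zReflect]

theorem ht_toT (L : ℕ) [NeZero L] (i : Fin d) (c₀ : ℤ) (x : Fin d → ℤ) (h0 : c₀ ≤ x i) (hL : x i < c₀ + L) :
    ((ht i (c₀ : ZMod L) (Torus.proj L x) : ℕ) : ℤ) = x i - c₀ := by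
  unfold ht
  have : (Torus.proj L x) i - (c₀ : ZMod L) = ((x i - c₀ : ℤ) : ZMod L) := by simp [Torus.proj]
  rw [this, ZMod.val_intCast]
  exact Int.emod_eq_of_lt (by omega) (by omega)

theorem isUpper_toT {L : ℕ} [NeZero L] {i : Fin d} {c₀ : ℤ} {H : ℕ} (hHL : H < L) {p : ZdPlaquette d}
    (hp : ZIsUpper i c₀ H p) : IsUpper i (c₀ : ZMod L) H (toT L p) := by
  have hT : Touches i (toT L p) ↔ ZTouches i p := Iff.rfl
  unfold IsUpper
  rw [hT]
  unfold ZIsUpper at hp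
  have hx : c₀ ≤ p.1 i ∧ p.1 i < c₀ + L := by rcases hp with h | h <;> constructor <;> omega
  have hh := ht_toT L i c₀ p.1 hx.1 hx.2
  change ((ht i (c₀ : ZMod L) (toT L p).1 : ℕ) : ℤ) = p.1 i - c₀ at hh
  rcases hp with h | h
  · left; exact ⟨h.1, by omega⟩
  · right; exact ⟨h.1, by omega⟩

theorem isFace_toT_iff {L : ℕ} [NeZero L] {i : Fin d} {c₀ : ℤ} {H : ℕ} (hHL : H < L) {p : ZdPlaquette d}
    (hp : ZIsUpper i c₀ H p) : IsFace i (c₀ : ZMod L) (toT L p) ↔ ZIsFace i c₀ p := by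
  have hT : Touches i (toT L p) ↔ ZTouches i p := Iff.rfl
  unfold IsFace ZIsFace
  rw [hT]
  unfold ZIsUpper at hp
  have hx : c₀ ≤ p.1 i ∧ p.1 i < c₀ + L := by rcases hp with h | h <;> constructor <;> omega
  have hh := ht_toT L i c₀ p.1 hx.1 hx.2
  change ((ht i (c₀ : ZMod L) (toT L p).1 : ℕ) : ℤ) = p.1 i - c₀ at hh
  constructor
  · rintro ⟨h1, h2⟩; exact ⟨h1, by omega⟩
  · rintro ⟨h1, h2⟩; exact ⟨h1, by omega⟩

variable {N : ℕ} {G : Type*} [Group G] [TopologicalSpace G] [IsTopologicalGroup G] [CompactSpace G]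
  [MeasurableSpace G] [BorelSpace G] [SecondCountableTopology G]
variable (ρ : G →* Matrix (Fin N) (Fin N) ℂ) (β : ℝ)

/-- The free-boundary partition function `Z(A) = ∫ ∏_{p ∈ A} exp(-β (N - Re tr ρ(U_p))) dg_∞` of a finite
set of plaquettes of `ℤ^d` (the tree's `ℨ⟦β, A⟧`). -/
def zdZ (A : Finset (ZdPlaquette d)) : ℝ :=
  ∫ U, ∏ p ∈ A, Real.exp (-β * ((N : ℝ) - plaquetteObs ρ p.1 p.2.1.1 p.2.1.2 U)) ∂zdHaar d G

omit [SecondCountableTopology G] in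
theorem zdZ_nonneg (A : Finset (ZdPlaquette d)) : 0 ≤ zdZ ρ β A :=
  integral_nonneg fun _ => prod_nonneg fun _ _ => (Real.exp_pos _).le

/-- **The doubling inequality on `ℤ^d`**: for a finite set `I` of upper plaquettes of range `H` above the
hyperplane `x_i = c₀` (placed inside `[0, L-2]^d` together with its double, `2H < L`),
`Z(I)² ≤ Z(I ∪ θ(I ∖ faces))`. -/
theorem zdZ_sq_le_zdZ_zDouble (hρ : Continuous ρ) (hρN : ∀ g, (ρ g).trace.re ≤ N) (hβ : 0 ≤ β)
    (i : Fin d) (c₀ : ℤ) {H L : ℕ} [NeZero L] (hH : 2 * H < L) {I : Finset (ZdPlaquette d)}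
    (hup : ∀ p ∈ I, ZIsUpper i c₀ H p) (hI : ∀ p ∈ I, ∀ k, 0 ≤ p.1 k ∧ p.1 k + 2 ≤ L)
    (hD : ∀ p ∈ zDouble i c₀ I, ∀ k, 0 ≤ p.1 k ∧ p.1 k + 2 ≤ L) :
    zdZ ρ β I ^ 2 ≤ zdZ ρ β (zDouble i c₀ I) := by
  have hHL : H < L := by omega
  have hA : ∀ q ∈ I.image (toT L), IsUpper i (c₀ : ZMod L) H q := by
    intro q hq
    obtain ⟨p, hp, rfl⟩ := mem_image.1 hq
    exact isUpper_toT hHL (hup p hp)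
  have key := sq_integral_prod_tw_le ρ β hρ hρN hβ hH hA
  have hset : I.image (toT L) ∪ ((I.image (toT L)).filter fun q => ¬ IsFace i (c₀ : ZMod L) q).image
      (plaqReflect i (c₀ : ZMod L)) = (zDouble i c₀ I).image (toT L) := by
    rw [zDouble, image_union, Finset.filter_image, image_image, image_image]
    congr 1
    have hf : (I.filter fun p => ¬ IsFace i (c₀ : ZMod L) (toT L p)) = I.filter fun p => ¬ ZIsFace i c₀ p :=
      filter_congr fun p hp => by rw [isFace_toT_iff hHL (hup p hp)]
    rw [hf]
    exact image_congr fun p _ => by simp [Function.comp, toT_zPlaqReflect]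
  rw [hset] at key
  have e1 : (∫ U, ∏ p ∈ I.image (toT L), tw ρ β p U ∂(Measure.pi fun _ : Edge d L => haarProbability G)) =
      zdZ ρ β I := FreeEnergy.integral_torusWeight_image ρ hρ β hI
  have e2 : (∫ U, ∏ p ∈ (zDouble i c₀ I).image (toT L), tw ρ β p U
      ∂(Measure.pi fun _ : Edge d L => haarProbability G)) = zdZ ρ β (zDouble i c₀ I) :=
    FreeEnergy.integral_torusWeight_image ρ hρ β hD
  rw [e1, e2] at key
  exact key

end Zd

/-! ## §5 Boxes: `d` successive reflections double a cube, `Z(B_m)^(2^d) ≤ Z(B_{2m-1})` -/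

section Boxes

open scoped Classical
open Literature.Probability.LatticeModels (halfOpenBox Torus.proj)

variable {d : ℕ}

/-- `1` if the plaquette extends in direction `k`, else `0`. -/
def bump (p : ZdPlaquette d) (k : Fin d) : ℤ := if ZTouches k p then 1 else 0

theorem bump_nonneg (p : ZdPlaquette d) (k : Fin d) : 0 ≤ bump p k := by
  unfold bump; split_ifs <;> norm_num

theorem bump_le_one (p : ZdPlaquette d) (k : Fin d) : bump p k ≤ 1 := by
  unfold bump; split_ifs <;> norm_num

theorem bump_of_touches {p : ZdPlaquette d} {k : Fin d} (h : ZTouches k p) : bump p k = 1 := if_pos h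

theorem bump_of_not_touches {p : ZdPlaquette d} {k : Fin d} (h : ¬ ZTouches k p) : bump p k = 0 := if_neg h

theorem bump_eq (p : ZdPlaquette d) (k : Fin d) :
    bump p k = (if k = p.2.1.1 then 1 else 0) + (if k = p.2.1.2 then 1 else 0) := by
  have hne : p.2.1.1 ≠ p.2.1.2 := ne_of_lt p.2.2
  unfold bump ZTouches
  by_cases h1 : k = p.2.1.1 <;> by_cases h2 : k = p.2.1.2
  · exact absurd (h1.symm.trans h2) hne
  · rw [if_pos (Or.inl h1.symm), if_pos h1, if_neg h2]; norm_num
  · rw [if_pos (Or.inr h2.symm), if_neg h1, if_pos h2]; norm_num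
  · rw [if_neg (by rintro (h | h) <;> [exact h1 h.symm; exact h2 h.symm]), if_neg h1, if_neg h2]; norm_num

/-- `(zPlaqReflect p).2 = p.2`, so bumps are unchanged. -/
theorem bump_zPlaqReflect (i : Fin d) (c₀ : ℤ) (p : ZdPlaquette d) (k : Fin d) :
    bump (zPlaqReflect i c₀ p) k = bump p k := rfl

theorem zPlaqReflect_fst_self_of_touches {i : Fin d} (c₀ : ℤ) {p : ZdPlaquette d} (h : ZTouches i p) :
    (zPlaqReflect i c₀ p).1 i = c₀ + c₀ - p.1 i - 1 := by
  simp [zPlaqReflect, h, zReflect]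

theorem zPlaqReflect_fst_self_of_not {i : Fin d} (c₀ : ℤ) {p : ZdPlaquette d} (h : ¬ ZTouches i p) :
    (zPlaqReflect i c₀ p).1 i = c₀ + c₀ - p.1 i := by
  simp [zPlaqReflect, h, zReflect]

theorem zPlaqReflect_fst_ne (i : Fin d) (c₀ : ℤ) (p : ZdPlaquette d) {k : Fin d} (hk : k ≠ i) :
    (zPlaqReflect i c₀ p).1 k = p.1 k := by
  unfold zPlaqReflect
  split_ifs <;> simp [zReflect, hk]

theorem zReflect_zReflect (i : Fin d) (c₀ : ℤ) (x : Fin d → ℤ) : zReflect i c₀ (zReflect i c₀ x) = x := by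
  ext k
  by_cases hk : k = i
  · subst hk; simp [zReflect]
  · simp [zReflect, hk]

theorem zReflect_sub_single (i : Fin d) (c₀ : ℤ) (x : Fin d → ℤ) :
    zReflect i c₀ (x - Pi.single i 1) = zReflect i c₀ x + Pi.single i 1 := by
  ext k
  by_cases hk : k = i
  · subst hk; simp [zReflect]; ring
  · simp [zReflect, hk]

theorem zPlaqReflect_zPlaqReflect (i : Fin d) (c₀ : ℤ) (p : ZdPlaquette d) :
    zPlaqReflect i c₀ (zPlaqReflect i c₀ p) = p := by
  obtain ⟨x, jk⟩ := p
  unfold zPlaqReflect ZTouches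
  by_cases h : jk.1.1 = i ∨ jk.1.2 = i
  · simp only [h, if_true, zReflect_sub_single, zReflect_zReflect, add_sub_cancel_right]
  · simp only [h, if_false, zReflect_zReflect]

/-- The plaquettes of the closed lattice box `∏_k [lo_k, hi_k]` (all four corners inside). -/
def boxPlaqs (lo hi : Fin d → ℤ) : Finset (ZdPlaquette d) :=
  ((Fintype.piFinset fun k => Finset.Icc (lo k) (hi k)) ×ˢ Finset.univ).filter fun p => ∀ k, p.1 k + bump p k ≤ hi k

theorem mem_boxPlaqs {lo hi : Fin d → ℤ} {p : ZdPlaquette d} :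
    p ∈ boxPlaqs lo hi ↔ ∀ k, lo k ≤ p.1 k ∧ p.1 k + bump p k ≤ hi k := by
  unfold boxPlaqs
  rw [mem_filter, mem_product, Fintype.mem_piFinset]
  simp only [mem_Icc, mem_univ, and_true]
  constructor
  · rintro ⟨h1, h2⟩ k; exact ⟨(h1 k).1, h2 k⟩
  · intro h
    refine ⟨fun k => ⟨(h k).1, ?_⟩, fun k => (h k).2⟩
    have := (h k).2; have := bump_nonneg p k; omega

/-- Chatterjee's cube `cubePlaqs d n` (plaquettes with all corners in `[0,n)^d`) in coordinates. -/
theorem mem_cubePlaqs_iff (n : ℕ) (p : ZdPlaquette d) :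
    p ∈ ChatterjeeFreeEnergy.cubePlaqs d n ↔ ∀ k, 0 ≤ p.1 k ∧ p.1 k + bump p k + 1 ≤ n := by
  have hne : p.2.1.1 ≠ p.2.1.2 := ne_of_lt p.2.2
  unfold ChatterjeeFreeEnergy.cubePlaqs
  rw [mem_filter, FreeEnergy.mem_boxPlaqs, Plaq.mem_plaquettesIn]
  simp only [Plaq.ofZd, Literature.Probability.LatticeModels.mem_halfOpenBox, Pi.add_apply, Pi.single_apply,
    bump_eq]
  constructor
  · rintro ⟨h0, -, -, -, -, h3⟩ k
    have a0 := h0 k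
    have a3 := h3 k
    refine ⟨a0.1, ?_⟩
    by_cases e1 : k = p.2.1.1 <;> by_cases e2 : k = p.2.1.2 <;>
      simp only [e1, e2, hne, hne.symm, if_true, if_false] at a3 ⊢ <;> omega
  · intro h
    refine ⟨fun k => ⟨(h k).1, ?_⟩, fun k => ⟨(h k).1, ?_⟩, p.2.2, fun k => ?_, fun k => ?_, fun k => ?_⟩ <;>
    · have a := h k
      by_cases e1 : k = p.2.1.1 <;> by_cases e2 : k = p.2.1.2 <;>
        simp only [e1, e2, hne, hne.symm, if_true, if_false] at a ⊢ <;> omega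

theorem cubePlaqs_eq_boxPlaqs (n : ℕ) :
    ChatterjeeFreeEnergy.cubePlaqs d n = boxPlaqs (fun _ => (0 : ℤ)) (fun _ => (n : ℤ) - 1) := by
  ext p
  rw [mem_cubePlaqs_iff, mem_boxPlaqs]
  exact forall_congr' fun k => by constructor <;> rintro ⟨h1, h2⟩ <;> exact ⟨h1, by omega⟩

/-- Translating a box of plaquettes. -/
theorem boxPlaqs_image_shift (lo hi v : Fin d → ℤ) :
    (boxPlaqs lo hi).image (fun p : ZdPlaquette d => (p.1 + v, p.2)) = boxPlaqs (lo + v) (hi + v) := by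
  ext q
  constructor
  · intro hq
    obtain ⟨p, hp, rfl⟩ := mem_image.1 hq
    rw [mem_boxPlaqs] at hp ⊢
    intro k
    have := hp k
    have hb : bump ((p.1 + v, p.2) : ZdPlaquette d) k = bump p k := rfl
    simp only [Pi.add_apply, hb]
    omega
  · intro hq
    rw [mem_boxPlaqs] at hq
    refine mem_image.2 ⟨(q.1 - v, q.2), ?_, ?_⟩
    · rw [mem_boxPlaqs]
      intro k
      have := hq k
      have hb : bump ((q.1 - v, q.2) : ZdPlaquette d) k = bump q k := rfl
      simp only [Pi.sub_apply, Pi.add_apply, hb] at this ⊢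
      omega
    · simp

/-- **Reflecting a box in its bottom face doubles it**:
`B ∪ θ(B ∖ face) = ` the box with `lo_i` replaced by `2 lo_i - hi_i`. -/
theorem zDouble_boxPlaqs (lo hi : Fin d → ℤ) (i : Fin d) (hi_ : lo i ≤ hi i) :
    zDouble i (lo i) (boxPlaqs lo hi) = boxPlaqs (Function.update lo i (2 * lo i - hi i)) hi := by
  ext q
  rw [zDouble, mem_union, mem_image]
  constructor
  · rintro (hq | ⟨p, hp, rfl⟩)
    · rw [mem_boxPlaqs] at hq ⊢
      intro k
      have := hq k
      by_cases hk : k = i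
      · subst hk; rw [Function.update_self]; omega
      · rw [Function.update_of_ne hk]; exact this
    · rw [mem_filter, mem_boxPlaqs] at hp
      obtain ⟨hp, hnf⟩ := hp
      rw [mem_boxPlaqs]
      intro k
      by_cases hk : k = i
      · subst hk
        rw [Function.update_self, bump_zPlaqReflect]
        have hpk := hp k
        by_cases ht : ZTouches k p
        · rw [zPlaqReflect_fst_self_of_touches (lo k) ht]
          rw [bump_of_touches ht] at hpk ⊢
          omega
        · rw [zPlaqReflect_fst_self_of_not (lo k) ht]
          rw [bump_of_not_touches ht] at hpk ⊢
          have hne : p.1 k ≠ lo k := fun h => hnf ⟨ht, h⟩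
          omega
      · rw [Function.update_of_ne hk, bump_zPlaqReflect, zPlaqReflect_fst_ne i (lo i) p hk]
        exact hp k
  · intro hq
    rw [mem_boxPlaqs] at hq
    by_cases hqi : lo i ≤ q.1 i
    · left
      rw [mem_boxPlaqs]
      intro k
      have := hq k
      by_cases hk : k = i
      · subst hk; exact ⟨hqi, this.2⟩
      · rw [Function.update_of_ne hk] at this; exact this
    · right
      push Not at hqi
      have hqi' := hq i
      rw [Function.update_self] at hqi'
      refine ⟨zPlaqReflect i (lo i) q, ?_, zPlaqReflect_zPlaqReflect i (lo i) q⟩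
      rw [mem_filter, mem_boxPlaqs]
      refine ⟨fun k => ?_, ?_⟩
      · by_cases hk : k = i
        · subst hk
          rw [bump_zPlaqReflect]
          by_cases ht : ZTouches k q
          · rw [zPlaqReflect_fst_self_of_touches (lo k) ht]
            rw [bump_of_touches ht] at hqi' ⊢
            omega
          · rw [zPlaqReflect_fst_self_of_not (lo k) ht]
            rw [bump_of_not_touches ht] at hqi' ⊢
            omega
        · have := hq k
          rw [Function.update_of_ne hk] at this
          rw [bump_zPlaqReflect, zPlaqReflect_fst_ne i (lo i) q hk]
          exact this
      · have hT : ZTouches i (zPlaqReflect i (lo i) q) ↔ ZTouches i q := Iff.rfl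
        unfold ZIsFace
        rw [hT]
        rintro ⟨hnt, hc0⟩
        rw [zPlaqReflect_fst_self_of_not (lo i) hnt] at hc0
        omega

/-- Lower corners after reflecting in the first `k` coordinate directions. -/
def loK (lo hi : Fin d → ℤ) (k : ℕ) : Fin d → ℤ := fun l => if (l : ℕ) < k then 2 * lo l - hi l else lo l

theorem loK_zero (lo hi : Fin d → ℤ) : loK lo hi 0 = lo := by
  funext l; simp [loK]

theorem loK_apply_of_eq (lo hi : Fin d → ℤ) {k : ℕ} {i : Fin d} (h : (i : ℕ) = k) : loK lo hi k i = lo i := by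
  simp [loK, h]

theorem loK_succ (lo hi : Fin d → ℤ) {k : ℕ} {i : Fin d} (h : (i : ℕ) = k) :
    Function.update (loK lo hi k) i (2 * lo i - hi i) = loK lo hi (k + 1) := by
  funext l
  by_cases hl : l = i
  · subst hl; rw [Function.update_self]; simp [loK, h]
  · rw [Function.update_of_ne hl]
    have hl' : (l : ℕ) ≠ k := fun h' => hl (Fin.ext (h'.trans h.symm))
    simp only [loK]
    by_cases h1 : (l : ℕ) < k
    · rw [if_pos h1, if_pos (by omega)]
    · rw [if_neg h1, if_neg (by omega)]

theorem loK_of_le (lo hi : Fin d → ℤ) {k : ℕ} (hk : d ≤ k) : loK lo hi k = fun l => 2 * lo l - hi l := by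
  funext l; simp [loK, show (l : ℕ) < k from by omega]

theorem loK_nonneg (lo hi : Fin d → ℤ) (hlohi : ∀ l, lo l ≤ hi l) (hpos : ∀ l, 0 ≤ 2 * lo l - hi l) (k : ℕ)
    (l : Fin d) : 0 ≤ loK lo hi k l := by
  have := hlohi l; have := hpos l
  simp only [loK]; split_ifs <;> omega

variable {N : ℕ} {G : Type*} [Group G] [TopologicalSpace G] [IsTopologicalGroup G] [CompactSpace G]
  [MeasurableSpace G] [BorelSpace G] [SecondCountableTopology G]
variable (ρ : G →* Matrix (Fin N) (Fin N) ℂ) (β : ℝ)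

/-- `k` successive reflections: `Z(box)^(2^k) ≤ Z(box reflected in directions 0, …, k-1)`. -/
theorem zdZ_boxPlaqs_pow_le (hρ : Continuous ρ) (hρN : ∀ g, (ρ g).trace.re ≤ N) (hβ : 0 ≤ β)
    (lo hi : Fin d → ℤ) (hlohi : ∀ l, lo l ≤ hi l) (hpos : ∀ l, 0 ≤ 2 * lo l - hi l)
    {L : ℕ} [NeZero L] (hL1 : ∀ l, 2 * (hi l - lo l) < L) (hL2 : ∀ l, hi l + 2 ≤ L) :
    ∀ k, k ≤ d → zdZ ρ β (boxPlaqs lo hi) ^ (2 ^ k) ≤ zdZ ρ β (boxPlaqs (loK lo hi k) hi)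
  | 0, _ => by simp [loK_zero]
  | k + 1, hk => by
      have ih := zdZ_boxPlaqs_pow_le hρ hρN hβ lo hi hlohi hpos hL1 hL2 k (by omega)
      have hkd : k < d := by omega
      obtain ⟨i, hik⟩ : ∃ i : Fin d, (i : ℕ) = k := ⟨⟨k, hkd⟩, rfl⟩
      obtain ⟨H, hHdef⟩ := Int.eq_ofNat_of_zero_le (sub_nonneg.2 (hlohi i))
      have hc : loK lo hi k i = lo i := loK_apply_of_eq lo hi hik
      have hbox : zDouble i (lo i) (boxPlaqs (loK lo hi k) hi) = boxPlaqs (loK lo hi (k + 1)) hi := by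
        have h := zDouble_boxPlaqs (loK lo hi k) hi i (by rw [hc]; exact hlohi i)
        rw [hc] at h
        rw [h, ← loK_succ lo hi hik]
      have hmem : ∀ k', ∀ p ∈ boxPlaqs (loK lo hi k') hi, ∀ l, 0 ≤ p.1 l ∧ p.1 l + 2 ≤ L := by
        intro k' p hp l
        have h1 := (mem_boxPlaqs.1 hp) l
        have h2 := loK_nonneg lo hi hlohi hpos k' l
        have h3 := bump_nonneg p l
        have h4 := hL2 l
        constructor <;> omega
      have hup : ∀ p ∈ boxPlaqs (loK lo hi k) hi, ZIsUpper i (lo i) H p := by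
        intro p hp
        have h1 := (mem_boxPlaqs.1 hp) i
        rw [hc] at h1
        unfold ZIsUpper
        by_cases ht : ZTouches i p
        · right; rw [bump_of_touches ht] at h1; exact ⟨ht, h1.1, by omega⟩
        · left; rw [bump_of_not_touches ht] at h1; exact ⟨ht, h1.1, by omega⟩
      have hHL : 2 * H < L := by have := hL1 i; omega
      have step : zdZ ρ β (boxPlaqs (loK lo hi k) hi) ^ 2 ≤ zdZ ρ β (boxPlaqs (loK lo hi (k + 1)) hi) := by
        rw [← hbox]
        exact zdZ_sq_le_zdZ_zDouble ρ β hρ hρN hβ i (lo i) hHL hup (hmem k) (by rw [hbox]; exact hmem (k + 1))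
      calc zdZ ρ β (boxPlaqs lo hi) ^ 2 ^ (k + 1) = (zdZ ρ β (boxPlaqs lo hi) ^ 2 ^ k) ^ 2 := by
            rw [pow_succ, pow_mul]
        _ ≤ zdZ ρ β (boxPlaqs (loK lo hi k) hi) ^ 2 :=
            pow_le_pow_left₀ (pow_nonneg (zdZ_nonneg ρ β _) _) ih 2
        _ ≤ _ := step

/-- **Free-cube doubling.** `Z([0,m)^d)^(2^d) ≤ Z([0,2m-1)^d)` for the free-boundary Wilson partition functions of
any compact gauge group, any `β ≥ 0`, any `m ≥ 1` (Glimm–Jaffe multiple reflections for product Haar measure). -/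
theorem zdZ_cubePlaqs_pow_le (hρ : Continuous ρ) (hρN : ∀ g, (ρ g).trace.re ≤ N) (hβ : 0 ≤ β) {m : ℕ}
    (hm : 1 ≤ m) :
    zdZ ρ β (ChatterjeeFreeEnergy.cubePlaqs d m) ^ (2 ^ d) ≤
      zdZ ρ β (ChatterjeeFreeEnergy.cubePlaqs d (2 * m - 1)) := by
  set lo : Fin d → ℤ := fun _ => (m : ℤ) - 1 with hlo
  set hi : Fin d → ℤ := fun _ => 2 * (m : ℤ) - 2 with hhi
  have hshift : (boxPlaqs (fun _ => (0 : ℤ)) (fun _ => (m : ℤ) - 1)).image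
      (fun p : ZdPlaquette d => (p.1 + lo, p.2)) = boxPlaqs lo hi := by
    rw [boxPlaqs_image_shift]
    congr 1 <;> funext l <;> simp [hlo, hhi]; ring
  have h1 : zdZ ρ β (ChatterjeeFreeEnergy.cubePlaqs d m) = zdZ ρ β (boxPlaqs lo hi) := by
    rw [cubePlaqs_eq_boxPlaqs, ← hshift]
    exact (FreeEnergy.zdZ_image_shift ρ hρ β lo _).symm
  have h2 : boxPlaqs (loK lo hi d) hi = ChatterjeeFreeEnergy.cubePlaqs d (2 * m - 1) := by
    rw [loK_of_le lo hi le_rfl, cubePlaqs_eq_boxPlaqs]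
    have hcast : ((2 * m - 1 : ℕ) : ℤ) = 2 * (m : ℤ) - 1 := by omega
    congr 1 <;> funext l <;> simp only [hlo, hhi, hcast] <;> ring
  haveI : NeZero (2 * m + 1) := ⟨by omega⟩
  have h3 := zdZ_boxPlaqs_pow_le ρ β hρ hρN hβ lo hi (fun l => by simp only [hlo, hhi]; omega)
    (fun l => by simp only [hlo, hhi]; omega) (L := 2 * m + 1)
    (fun l => by simp only [hlo, hhi]; push_cast; omega) (fun l => by simp only [hhi]; push_cast; omega) d le_rfl
  rw [h1, ← h2]
  exact h3

/-- The same in terms of the tree's `zdPartitionFunction` on half-open site boxes, `d = 4`: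
`Z(B_m)^16 ≤ Z(B_{2m-1})` — the hypothesis `FreeCubeRPDoubling` of `Lines/pressure_monotone_tm.lean` §5. -/
theorem zdPartitionFunction_halfOpenBox_pow_sixteen_le (hρ : Continuous ρ) (hρN : ∀ g, (ρ g).trace.re ≤ N)
    (hβ : 0 ≤ β) {m : ℕ} (hm : 1 ≤ m) :
    (zdPartitionFunction ρ β (halfOpenBox 4 m)).toReal ^ 16 ≤
      (zdPartitionFunction ρ β (halfOpenBox 4 (2 * m - 1))).toReal := by
  rw [ChatterjeeFreeEnergy.zdPartitionFunction_toReal_eq ρ hρ β m,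
    ChatterjeeFreeEnergy.zdPartitionFunction_toReal_eq ρ hρ β (2 * m - 1)]
  have h := zdZ_cubePlaqs_pow_le (d := 4) ρ β hρ hρN hβ hm
  norm_num at h
  exact h

end Boxes

end

end Summit.QuantumFields.YangMills.Cruxes.IR.RPDoubling
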